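import Literature.Barriers.PneNP.MatchingSlackPsdRankSmall
import Literature.Combinatorics.Optimization.RationalPsdRank
import Literature.Combinatorics.Optimization.PsdFactorNorms
import Literature.Combinatorics.Optimization.SymmetricSDPMatching
import Literature.Combinatorics.AssociationSchemes.CutMatchingRestriction
import HarnessLib

/-!
# `rk_psd(S_odd(K₈)) ≥ 10`: the first psd-rank lower bound for Edmonds' slack matrix beyond the fooling-set bound

Companion to `MatchingSlackPsdRankSmall.lean` (there: the triangular/fooling-set bound `9 ≤ rk_psd(S_odd(K₈))`,
which an exhaustive search shows to be the LARGEST triangular pattern, and the exact `S₈`-equivariant factorisation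
`rk_psd(S_odd(K₈)) ≤ 14 = Catalan(4)`). Here we prove, for the odd-cut slack matrix
`S_{UM} = |δ(U) ∩ M| − 1` of the perfect matching polytope of `K₈` (`pmOddCutSlack 8`, rows `OddSet 8`, columns
`PMatch 8`),

  `¬ HasPsdFactorization (pmOddCutSlack 8) 9`, hence `10 ≤ rk_psd(S_odd(K₈)) ≤ 14`

(`not_hasPsdFactorization_pmOddCutSlack_eight_nine`, `ten_le_of_hasPsdFactorization_eight`,
`pmOddCutSlack_eight_psdRank_window`). The argument is the Gouveia–Robinson–Thomas / Lee–Theis rank-one mechanism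
[GouveiaRobinsonThomas2013, Prop. 2.6 + Lemma 2.4 (p05–p07); used there for Ex. 4.5, tree file
`OctahedronPsdRankFive.lean`] combined with a parity count of Hadamard square roots [GouveiaRobinsonThomas2013,
Ex. 2.3 (p05): "every Hadamard square root has odd determinant", tree `PsdFactorNorms.lean` §GrtEx23], run on the
`56 × 105` block of `3`-set rows:

1. (compression, §3) every `3`-set row `U` has, inside the `45` columns `M` with `S_{UM} = 0`, a triangular
   `8`-pattern of the other rows, and every column `M` has, inside the `24` rows vanishing at `M`, a triangular
   `8`-pattern of the other columns; by the tree's `rank_rowFactor_add_le_of_triangular` /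
   `rank_colFactor_add_le_of_triangular` every factor of a size-`9` psd factorisation has rank `≤ 9 − 8 = 1`.
   The two patterns are decided by the kernel for the row `{0,1,2}` and the column `{01,23,45,67}` and TRANSPORTED
   to all rows/columns by vertex permutations (`S₈` is transitive on `3`-sets and on perfect matchings:
   tree `exists_perm_fixing_image_eq`, `exists_conj_eq`; crossing numbers are relabelling-invariant:
   tree `crossCount_image`).
2. (square roots, §4) rank-one factors make `S` the Hadamard square of a real matrix `N` of rank `≤ 9`
   (FGPRT Prop. 6.2, tree `FawziEtAl2015_prop62_holds`).
3. (parity, §5) but EVERY real `N` with `N ∘ N = S` has rank `≥ 10`: `S ∈ {0, 2}`, so on an explicit `10 × 10`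
   minor `N = √2 · Z` with `Z` an integer sign matrix congruent mod `2` to the `0/1` support matrix `X`, and `X` is
   invertible over `𝔽₂` (explicit inverse, kernel `decide`), so `det Z` is odd, `det N ≠ 0` on the minor.
   (The support of the `3`-set block has `𝔽₂`-rank `14`; a `10 × 10` unit minor suffices here.)

So at `n = 8` the psd rank of Edmonds' slack matrix is STRICTLY larger than every triangular-pattern bound —
the first value-dependent ("beyond support") lower bound for this matrix in the tree; the window is now
`[10, 14]` (numerically, three independent local-search engines of the cell find size `14` from every start and
never `13`). Honest limits: the method gains exactly one over the fooling bound and needs (i) `(τ−1)`-patterns in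
every zero set and (ii) `𝔽₂`-rank of the support `> τ`; whether (i)–(ii) hold for `K₁₀` (`τ = 14`) is being
checked by the cell, nothing asymptotic is claimed. Label: instrument / small exact theorem about the route
Target's object. WHAT THIS IS NOT: no statement about the crux `TracialDecayExp20` (stmt-PneNP-19878), nothing
about `n → ∞`, no P-vs-NP content.
-/

noncomputable section

open Finset Matrix Equiv

namespace Literature.Barriers.PneNP

open Literature.Combinatorics.Optimization
  (HasPsdFactorization HasHadamardSqrtOfRankLE FawziEtAl2015_prop62_holds rank_rowFactor_add_le_of_triangular
    rank_colFactor_add_le_of_triangular isPMOn_univ_image_map)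
open Literature.Combinatorics.AssociationSchemes.CutMatchingRestriction (crossCount crossCount_image cc_eq_crossCount)
open Literature.Combinatorics.AssociationSchemes.MatchingLevelInequality
  (fpfInvolutions mem_fpfInvolutions exists_perm_fixing_image_eq exists_conj_eq)
open Literature.Combinatorics.AssociationSchemes.HomogeneousMatchingFamilies
  (permOf edgesOf edgesOf_permOf permOf_mem_fpfInvolutions)

namespace PsdRankEightLower

/-! ### §1 The `3`-set block of `S_odd(K₈)` and vertex relabelling -/

/-- Row index type of the block: `3`-subsets of `Fin 8`. [cite: Rothvoss2017, §2 (PDF p. 5: odd cuts `δ(U)`)] -/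
abbrev T3 : Type := {U : Finset (Fin 8) // U.card = 3}

/-- A `3`-set is an odd set. [cite: Rothvoss2017, §2 (PDF p. 5)] -/
def toOdd (U : T3) : OddSet 8 := ⟨U.1, by rw [U.2]; decide⟩

/-- The `3`-set block `S₃(U, M) = cc(U, M) − 1` of the odd-cut slack matrix of `K₈`.
[cite: KaniewskiLeeDewolf2015, §7.3 (p. 12)] -/
def S3 (U : T3) (M : PMatch 8) : ℝ := pmOddCutSlack 8 (toOdd U) M

/-- Unfolding: `S₃(U, M) = cc(U, M) − 1`. [cite: KaniewskiLeeDewolf2015, §7.3 (p. 12)] -/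
theorem S3_apply (U : T3) (M : PMatch 8) : S3 U M = (cc (toOdd U) M : ℝ) - 1 := rfl

/-- `S₃(U, M) = 0 ↔ cc(U, M) = 1`. [cite: FawziEtAl2015, §5.2 (p15)] -/
theorem S3_eq_zero_iff (U : T3) (M : PMatch 8) : S3 U M = 0 ↔ cc (toOdd U) M = 1 := by
  rw [S3_apply, sub_eq_zero]
  exact_mod_cast Iff.rfl

/-- A psd factorisation of the full odd-cut slack matrix restricts to the `3`-set block.
[cite: FawziEtAl2015, Ex. 5.1 (p14, submatrix step)] -/
theorem hasPsdFactorization_S3 {r : ℕ} (h : HasPsdFactorization (pmOddCutSlack 8) r) : HasPsdFactorization S3 r :=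
  h.submatrix toOdd id

/-- Relabelling a `3`-set by a vertex permutation. [cite: Rothvoss2017, §2 (PDF p. 5)] -/
def imgT (σ : Perm (Fin 8)) (U : T3) : T3 :=
  ⟨U.1.image σ, by rw [card_image_of_injective _ σ.injective, U.2]⟩

/-- Relabelling a perfect matching by a vertex permutation. [cite: BraunEtAl2016, §4.5 (p. 9)] -/
def imgP (σ : Perm (Fin 8)) (M : PMatch 8) : PMatch 8 :=
  ⟨M.1.image (Sym2.map σ), isPMOn_univ_image_map σ M.2⟩

/-- Crossing numbers are invariant under simultaneous relabelling. [cite: Rothvoss2017, §2 (PDF p. 5)] -/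
theorem cc_imgT_imgP (σ : Perm (Fin 8)) (U : T3) (M : PMatch 8) :
    cc (toOdd (imgT σ U)) (imgP σ M) = cc (toOdd U) M := by
  rw [cc_eq_crossCount, cc_eq_crossCount]
  exact crossCount_image σ.injective U.1 M.1

/-- Hence the block entries are invariant under simultaneous relabelling. [cite: Rothvoss2017, §2 (PDF p. 5)] -/
theorem S3_imgT_imgP (σ : Perm (Fin 8)) (U : T3) (M : PMatch 8) : S3 (imgT σ U) (imgP σ M) = S3 U M := by
  rw [S3_apply, S3_apply, cc_imgT_imgP]

/-- The base row `U₀ = {0,1,2}`. [cite: Rothvoss2017, §2 (PDF p. 5)] -/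
def U0 : T3 := ⟨{0, 1, 2}, by decide⟩

/-- The base column `M₀ = {01, 23, 45, 67}`. [cite: Rothvoss2017, §2 (PDF p. 6)] -/
def M0 : PMatch 8 := ⟨{s(0, 1), s(2, 3), s(4, 5), s(6, 7)}, by decide⟩

/-- `S₈` is transitive on `3`-sets: every row is a relabelling of `U₀`.
[cite: KeevashLifshitz2023, §1.2 (p. 4)] -/
theorem exists_imgT_eq (U : T3) : ∃ σ : Perm (Fin 8), imgT σ U0 = U := by
  obtain ⟨σ, -, hσ⟩ := exists_perm_fixing_image_eq (n := 8) ((U0.1 \ U.1).card) ∅ U0.1 U.1 rfl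
    (by rw [U0.2, U.2]) (by simp)
  exact ⟨σ, Subtype.ext hσ⟩

/-- Conjugating a fixed-point-free involution relabels its edge set. [cite: GodsilMeagher2015, §15.2] -/
theorem edgesOf_conj (σ s : Perm (Fin 8)) : edgesOf (σ * s * σ⁻¹) = (edgesOf s).image (Sym2.map σ) := by
  ext e
  simp only [edgesOf, mem_image, mem_univ, true_and, Perm.mul_apply]
  constructor
  · rintro ⟨x, rfl⟩
    exact ⟨s(σ⁻¹ x, s (σ⁻¹ x)), ⟨σ⁻¹ x, rfl⟩, by simp⟩
  · rintro ⟨_, ⟨y, rfl⟩, rfl⟩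
    exact ⟨σ y, by simp⟩

/-- `S₈` is transitive on perfect matchings: every column is a relabelling of `M₀`.
[cite: GodsilMeagher2015, §15.2 (the perfect matchings form one `S_n`-orbit)] -/
theorem exists_imgP_eq (M : PMatch 8) : ∃ σ : Perm (Fin 8), imgP σ M0 = M := by
  obtain ⟨σ, hσ⟩ := exists_conj_eq (permOf_mem_fpfInvolutions M0.2) (permOf_mem_fpfInvolutions M.2)
  refine ⟨σ, Subtype.ext ?_⟩
  show M0.1.image (Sym2.map σ) = M.1
  rw [← edgesOf_permOf M.2, ← hσ, edgesOf_conj, edgesOf_permOf M0.2]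

/-! ### §2 The two base patterns (kernel `decide`) -/

/-- Rows of the base ROW pattern (eight `3`-sets). [cite: GouveiaRobinsonThomas2013, Prop. 2.6 (p06)] -/
def ρ0 : Fin 8 → T3 :=
  ![⟨{3, 4, 7}, by decide⟩, ⟨{3, 5, 6}, by decide⟩, ⟨{2, 4, 7}, by decide⟩, ⟨{0, 4, 7}, by decide⟩,
    ⟨{0, 2, 6}, by decide⟩, ⟨{0, 2, 3}, by decide⟩, ⟨{0, 1, 3}, by decide⟩, ⟨{0, 1, 4}, by decide⟩]

/-- Columns of the base ROW pattern (eight perfect matchings, all with `cc(U₀, ·) = 1`).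
[cite: GouveiaRobinsonThomas2013, Prop. 2.6 (p06)] -/
def γ0 : Fin 8 → PMatch 8 :=
  ![⟨{s(0, 7), s(1, 2), s(3, 6), s(4, 5)}, by decide⟩, ⟨{s(0, 2), s(1, 6), s(3, 4), s(5, 7)}, by decide⟩,
    ⟨{s(0, 2), s(1, 4), s(3, 7), s(5, 6)}, by decide⟩, ⟨{s(0, 1), s(2, 7), s(3, 4), s(5, 6)}, by decide⟩,
    ⟨{s(0, 5), s(1, 2), s(3, 6), s(4, 7)}, by decide⟩, ⟨{s(0, 6), s(1, 2), s(3, 5), s(4, 7)}, by decide⟩,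
    ⟨{s(0, 2), s(1, 5), s(3, 6), s(4, 7)}, by decide⟩, ⟨{s(0, 2), s(1, 3), s(4, 7), s(5, 6)}, by decide⟩]

/-- The base row pattern: its columns are zero columns of the row `U₀`, and it is triangular
(`cc ≠ 1` on the diagonal, `cc = 1` above it). [cite: GouveiaRobinsonThomas2013, Prop. 2.6 (p06)] -/
theorem rowPattern_base :
    (∀ a, cc (toOdd U0) (γ0 a) = 1) ∧ (∀ a, cc (toOdd (ρ0 a)) (γ0 a) ≠ 1) ∧
      ∀ a b : Fin 8, a < b → cc (toOdd (ρ0 a)) (γ0 b) = 1 := by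
  refine ⟨by decide, by decide, by decide⟩

/-- Rows of the base COLUMN pattern (eight `3`-sets, all with `cc(·, M₀) = 1`).
[cite: GouveiaRobinsonThomas2013, Prop. 2.6 (p06)] -/
def ρ1 : Fin 8 → T3 :=
  ![⟨{0, 4, 5}, by decide⟩, ⟨{2, 3, 6}, by decide⟩, ⟨{0, 1, 7}, by decide⟩, ⟨{4, 5, 6}, by decide⟩,
    ⟨{2, 3, 7}, by decide⟩, ⟨{0, 1, 6}, by decide⟩, ⟨{0, 2, 3}, by decide⟩, ⟨{0, 1, 2}, by decide⟩]

/-- Columns of the base COLUMN pattern. [cite: GouveiaRobinsonThomas2013, Prop. 2.6 (p06)] -/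
def γ1 : Fin 8 → PMatch 8 :=
  ![⟨{s(0, 2), s(1, 7), s(3, 5), s(4, 6)}, by decide⟩, ⟨{s(0, 5), s(1, 3), s(2, 7), s(4, 6)}, by decide⟩,
    ⟨{s(0, 4), s(1, 2), s(3, 6), s(5, 7)}, by decide⟩, ⟨{s(0, 5), s(1, 7), s(2, 6), s(3, 4)}, by decide⟩,
    ⟨{s(0, 7), s(1, 2), s(3, 6), s(4, 5)}, by decide⟩, ⟨{s(0, 4), s(1, 7), s(2, 3), s(5, 6)}, by decide⟩,
    ⟨{s(0, 1), s(2, 6), s(3, 7), s(4, 5)}, by decide⟩, ⟨{s(0, 7), s(1, 6), s(2, 3), s(4, 5)}, by decide⟩]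

/-- The base column pattern: its rows are zero rows of the column `M₀`, and it is triangular.
[cite: GouveiaRobinsonThomas2013, Prop. 2.6 (p06)] -/
theorem colPattern_base :
    (∀ a, cc (toOdd (ρ1 a)) M0 = 1) ∧ (∀ a, cc (toOdd (ρ1 a)) (γ1 a) ≠ 1) ∧
      ∀ a b : Fin 8, a < b → cc (toOdd (ρ1 a)) (γ1 b) = 1 := by
  refine ⟨by decide, by decide, by decide⟩

/-! ### §3 Compression: every factor of a size-`9` factorisation of the block has rank `≤ 1` -/

/-- **Rank-one factors.** In any psd factorisation of the `3`-set block of SIZE `9`, every row factor and every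
column factor has rank `≤ 1`: transport the base `8`-patterns to the zero set of the given row / column and apply
GRT Prop. 2.6's compression (`rank + 8 ≤ 9`). [cite: GouveiaRobinsonThomas2013, Prop. 2.6 (p06); Prop. 3.2 (p07)] -/
theorem factors_rank_le_one (A : T3 → Matrix (Fin 9) (Fin 9) ℝ) (B : PMatch 8 → Matrix (Fin 9) (Fin 9) ℝ)
    (hA : ∀ i, (A i).PosSemidef) (hB : ∀ j, (B j).PosSemidef) (hM : ∀ i j, S3 i j = (A i * B j).trace) :
    (∀ i, (A i).rank ≤ 1) ∧ ∀ j, (B j).rank ≤ 1 := by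
  obtain ⟨r0, r1, r2⟩ := rowPattern_base
  obtain ⟨c0, c1, c2⟩ := colPattern_base
  refine ⟨fun U => ?_, fun M => ?_⟩
  · obtain ⟨σ, rfl⟩ := exists_imgT_eq U
    have h := rank_rowFactor_add_le_of_triangular A B hA hB hM (imgT σ U0) (fun a => imgT σ (ρ0 a))
      (fun a => imgP σ (γ0 a))
      (fun a => by rw [S3_imgT_imgP, S3_eq_zero_iff]; exact r0 a)
      (fun a h => r1 a ((S3_eq_zero_iff _ _).1 (by rwa [S3_imgT_imgP] at h)))
      (fun a b hab => by rw [S3_imgT_imgP, S3_eq_zero_iff]; exact r2 a b hab)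
    omega
  · obtain ⟨σ, rfl⟩ := exists_imgP_eq M
    have h := rank_colFactor_add_le_of_triangular A B hA hB hM (imgP σ M0) (fun a => imgT σ (ρ1 a))
      (fun a => imgP σ (γ1 a))
      (fun a => by rw [S3_imgT_imgP, S3_eq_zero_iff]; exact c0 a)
      (fun a h => c1 a ((S3_eq_zero_iff _ _).1 (by rwa [S3_imgT_imgP] at h)))
      (fun a b hab => by rw [S3_imgT_imgP, S3_eq_zero_iff]; exact c2 a b hab)
    omega

/-! ### §4 Rank-one factors give a Hadamard square root of rank `≤ 9` -/

/-- A size-`9` psd factorisation of the block would give a real matrix `N` with `N ∘ N = S₃` and `rank N ≤ 9`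
(FGPRT Prop. 6.2 / GRT Lemma 2.4). [cite: FawziEtAl2015, Prop. 6.2 (p18)] -/
theorem hasHadamardSqrt_of_hasPsdFactorization_nine (h : HasPsdFactorization S3 9) : HasHadamardSqrtOfRankLE S3 9 := by
  obtain ⟨A, B, hA, hB, hM⟩ := h
  obtain ⟨hAr, hBr⟩ := factors_rank_le_one A B hA hB hM
  exact FawziEtAl2015_prop62_holds T3 (PMatch 8) S3 9 ⟨A, B, fun i => ⟨hA i, hAr i⟩, fun j => ⟨hB j, hBr j⟩, hM⟩

/-! ### §5 Parity: every Hadamard square root of the block has rank `≥ 10` -/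

/-- Rows of the `10 × 10` minor. [cite: GouveiaRobinsonThomas2013, Ex. 2.3 (p05)] -/
def ρm : Fin 10 → T3 :=
  ![⟨{1, 2, 7}, by decide⟩, ⟨{5, 6, 7}, by decide⟩, ⟨{1, 2, 4}, by decide⟩, ⟨{0, 2, 6}, by decide⟩,
    ⟨{0, 1, 4}, by decide⟩, ⟨{0, 1, 7}, by decide⟩, ⟨{2, 3, 6}, by decide⟩, ⟨{2, 6, 7}, by decide⟩,
    ⟨{1, 2, 5}, by decide⟩, ⟨{2, 3, 7}, by decide⟩]

/-- Columns of the `10 × 10` minor. [cite: GouveiaRobinsonThomas2013, Ex. 2.3 (p05)] -/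
def γm : Fin 10 → PMatch 8 :=
  ![⟨{s(0, 1), s(2, 3), s(4, 7), s(5, 6)}, by decide⟩, ⟨{s(0, 6), s(1, 2), s(3, 5), s(4, 7)}, by decide⟩,
    ⟨{s(0, 4), s(1, 7), s(2, 5), s(3, 6)}, by decide⟩, ⟨{s(0, 5), s(1, 4), s(2, 7), s(3, 6)}, by decide⟩,
    ⟨{s(0, 1), s(2, 6), s(3, 4), s(5, 7)}, by decide⟩, ⟨{s(0, 6), s(1, 4), s(2, 5), s(3, 7)}, by decide⟩,
    ⟨{s(0, 6), s(1, 7), s(2, 3), s(4, 5)}, by decide⟩, ⟨{s(0, 3), s(1, 6), s(2, 7), s(4, 5)}, by decide⟩,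
    ⟨{s(0, 1), s(2, 5), s(3, 4), s(6, 7)}, by decide⟩, ⟨{s(0, 6), s(1, 3), s(2, 4), s(5, 7)}, by decide⟩]

/-- The `0/1` support pattern `X` of the minor (as natural numbers). [cite: GouveiaRobinsonThomas2013, Ex. 2.3 (p05)] -/
def Xn : Fin 10 → Fin 10 → ℕ :=
  ![![1, 0, 0, 0, 1, 1, 0, 0, 1, 1], ![0, 1, 1, 1, 0, 1, 1, 1, 0, 0], ![1, 0, 1, 0, 1, 0, 1, 1, 1, 0],
    ![1, 0, 1, 1, 0, 0, 0, 1, 1, 0], ![0, 1, 0, 0, 0, 0, 1, 1, 0, 1], ![0, 1, 0, 1, 0, 1, 0, 1, 0, 1],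
    ![0, 1, 0, 0, 0, 1, 0, 1, 1, 1], ![1, 1, 1, 0, 0, 1, 1, 0, 0, 1], ![1, 0, 0, 1, 1, 0, 1, 1, 0, 1],
    ![0, 1, 1, 0, 1, 0, 0, 0, 1, 1]]

/-- On the minor the crossing numbers are `2·X + 1`, i.e. `S₃ = 2·X` with `X ∈ {0,1}` (kernel `decide`).
[cite: GouveiaRobinsonThomas2013, Ex. 2.3 (p05)] -/
theorem cc_minor : ∀ a b : Fin 10, cc (toOdd (ρm a)) (γm b) = 2 * Xn a b + 1 := by decide

/-- `X` is a `0/1` matrix. [cite: GouveiaRobinsonThomas2013, Ex. 2.3 (p05)] -/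
theorem Xn_le_one : ∀ a b : Fin 10, Xn a b ≤ 1 := by decide

/-- The support pattern over `𝔽₂`. [cite: GouveiaRobinsonThomas2013, Ex. 2.3 (p05)] -/
def X2 : Matrix (Fin 10) (Fin 10) (ZMod 2) := fun a b => (Xn a b : ZMod 2)

/-- An explicit inverse of `X` over `𝔽₂`. [cite: GouveiaRobinsonThomas2013, Ex. 2.3 (p05)] -/
def Y2 : Matrix (Fin 10) (Fin 10) (ZMod 2) :=
  !![0, 0, 1, 0, 1, 0, 0, 0, 0, 1; 0, 1, 1, 1, 0, 0, 1, 0, 0, 1; 1, 1, 0, 0, 0, 1, 0, 1, 0, 1;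
     0, 1, 1, 1, 0, 0, 0, 1, 1, 0; 0, 0, 1, 0, 0, 0, 1, 1, 0, 0; 0, 0, 0, 1, 1, 1, 1, 1, 0, 0;
     0, 1, 1, 0, 0, 0, 1, 0, 1, 0; 1, 1, 1, 1, 1, 0, 1, 1, 0, 0; 0, 1, 1, 1, 0, 1, 1, 1, 1, 0;
     1, 1, 1, 0, 0, 0, 1, 1, 1, 1]

/-- `X · Y = 1` over `𝔽₂` (kernel `decide`), so `det X = 1` in `𝔽₂`. [cite: GouveiaRobinsonThomas2013, Ex. 2.3 (p05)] -/
theorem X2_mul_Y2 : X2 * Y2 = 1 := by decide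

/-- `det X ≠ 0` over `𝔽₂`. [cite: GouveiaRobinsonThomas2013, Ex. 2.3 (p05)] -/
theorem det_X2_ne_zero : X2.det ≠ 0 := by
  intro h
  have h1 : (X2 * Y2).det = 1 := by rw [X2_mul_Y2, det_one]
  rw [det_mul, h, zero_mul] at h1
  exact zero_ne_one h1

/-- The integer SIGN MATRIX of a real matrix on the minor's support: `±X` according to the sign of the entry.
[cite: GouveiaRobinsonThomas2013, Ex. 2.3 (p05)] -/
def signMat (N' : Matrix (Fin 10) (Fin 10) ℝ) : Matrix (Fin 10) (Fin 10) ℤ :=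
  fun a b => if 0 ≤ N' a b then (Xn a b : ℤ) else -(Xn a b : ℤ)

/-- Modulo `2` the sign matrix is the support pattern `X` (as `−1 = 1` in `𝔽₂`).
[cite: GouveiaRobinsonThomas2013, Ex. 2.3 (p05)] -/
theorem signMat_map_zmod (N' : Matrix (Fin 10) (Fin 10) ℝ) : (signMat N').map (Int.cast : ℤ → ZMod 2) = X2 := by
  ext a b
  simp only [map_apply, X2, signMat]
  rcases Nat.le_one_iff_eq_zero_or_eq_one.1 (Xn_le_one a b) with h0 | h1
  · simp [h0]
  · rw [h1]
    split_ifs <;> decide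

/-- Hence the sign matrix has ODD, in particular nonzero, determinant. [cite: GouveiaRobinsonThomas2013, Ex. 2.3 (p05)] -/
theorem det_signMat_ne_zero (N' : Matrix (Fin 10) (Fin 10) ℝ) : (signMat N').det ≠ 0 := by
  intro h0
  apply det_X2_ne_zero
  have hmap : (((signMat N').det : ℤ) : ZMod 2) = ((signMat N').map (Int.cast : ℤ → ZMod 2)).det := by
    have := RingHom.map_det (Int.castRingHom (ZMod 2)) (signMat N')
    simpa [RingHom.mapMatrix_apply] using this
  rw [← signMat_map_zmod N', ← hmap, h0, Int.cast_zero]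

/-- **Every Hadamard square root of the block has rank `≥ 10`**: on the minor, `N = √2 · Z` with `Z` the integer
sign matrix, congruent to `X` modulo `2`, so `det Z` is odd and `det N ≠ 0`.
[cite: GouveiaRobinsonThomas2013, Ex. 2.3 (p05: every Hadamard square root has odd determinant)] -/
theorem ten_le_rank_of_sq_eq_S3 (N : Matrix T3 (PMatch 8) ℝ) (hN : ∀ i j, N i j ^ 2 = S3 i j) : 10 ≤ N.rank := by
  set N' : Matrix (Fin 10) (Fin 10) ℝ := N.submatrix ρm γm with hN'
  have hsq : ∀ a b, N' a b ^ 2 = 2 * (Xn a b : ℝ) := by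
    intro a b
    rw [hN', submatrix_apply, hN, S3_apply, cc_minor]
    push_cast
    ring
  have hs : Real.sqrt 2 ^ 2 = 2 := Real.sq_sqrt (by norm_num)
  have hZ : ∀ a b, N' a b = Real.sqrt 2 * ((signMat N' a b : ℤ) : ℝ) := by
    intro a b
    have h2 := hsq a b
    rcases Nat.le_one_iff_eq_zero_or_eq_one.1 (Xn_le_one a b) with h0 | h1
    · have hz : N' a b = 0 := by
        rw [h0, Nat.cast_zero, mul_zero] at h2
        exact (pow_eq_zero_iff (n := 2) (by norm_num)).1 h2
      simp [signMat, hz, h0]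
    · rw [h1, Nat.cast_one, mul_one] at h2
      have hfac : (N' a b - Real.sqrt 2) * (N' a b + Real.sqrt 2) = 0 := by
        have : (N' a b - Real.sqrt 2) * (N' a b + Real.sqrt 2) = N' a b ^ 2 - Real.sqrt 2 ^ 2 := by ring
        rw [this, hs, h2]; ring
      rcases mul_eq_zero.1 hfac with hp | hm
      · have hval : N' a b = Real.sqrt 2 := by linarith
        have hnn : 0 ≤ N' a b := by rw [hval]; exact Real.sqrt_nonneg 2
        have hZ1 : signMat N' a b = 1 := by simp [signMat, hnn, h1]
        rw [hZ1, hval]; push_cast; ring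
      · have hval : N' a b = -Real.sqrt 2 := by linarith
        have hneg : ¬ 0 ≤ N' a b := by
          rw [hval, not_le, neg_lt_zero]; exact Real.sqrt_pos.2 (by norm_num)
        have hZm : signMat N' a b = -1 := by simp [signMat, hneg, h1]
        rw [hZm, hval]; push_cast; ring
  have hN'eq : N' = Real.sqrt 2 • ((signMat N').map (Int.cast : ℤ → ℝ)) := by
    ext a b
    rw [Matrix.smul_apply, map_apply, smul_eq_mul, hZ]
  -- hence `det N' ≠ 0` and the minor has rank `10`
  have hdetN' : N'.det ≠ 0 := by
    rw [hN'eq, det_smul, Fintype.card_fin]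
    have hmap : ((signMat N').map (Int.cast : ℤ → ℝ)).det = (((signMat N').det : ℤ) : ℝ) := by
      have := RingHom.map_det (Int.castRingHom ℝ) (signMat N')
      simpa [RingHom.mapMatrix_apply] using this.symm
    rw [hmap]
    refine mul_ne_zero (pow_ne_zero _ (Real.sqrt_ne_zero'.2 (by norm_num))) ?_
    exact_mod_cast det_signMat_ne_zero N'
  have hrank : N'.rank = 10 := by
    simpa using rank_of_isUnit N' ((isUnit_iff_isUnit_det _).2 (isUnit_iff_ne_zero.2 hdetN'))
  calc 10 = N'.rank := hrank.symm
    _ ≤ N.rank := by rw [hN']; exact rank_submatrix_le N ρm γm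

/-! ### §6 The theorems -/

/-- **The `3`-set block of `S_odd(K₈)` has no psd factorisation of size `9`.**
[cite: GouveiaRobinsonThomas2013, Prop. 2.6 + Lemma 2.4 + Ex. 2.3 (p05–p07)] -/
theorem not_hasPsdFactorization_S3_nine : ¬ HasPsdFactorization S3 9 := by
  intro h
  obtain ⟨N, hN, hr⟩ := hasHadamardSqrt_of_hasPsdFactorization_nine h
  have := ten_le_rank_of_sq_eq_S3 N hN
  omega

end PsdRankEightLower

open PsdRankEightLower

/-- **`rk_psd(S_odd(K₈)) ≥ 10`**: Edmonds' odd-cut slack matrix of `K₈` has NO psd factorisation of size `9` —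
one more than the largest triangular pattern (`9`, `PsdRankSmall.isSupportBasedPsdBound_eight`; exhaustively
maximal). Mechanism: GRT rank-one compression on every row and column + parity of Hadamard square roots.
[cite: GouveiaRobinsonThomas2013, Prop. 2.6 + Lemma 2.4 + Ex. 2.3 (p05–p07); FawziEtAl2015, Prop. 6.2 (p18)] -/
theorem not_hasPsdFactorization_pmOddCutSlack_eight_nine : ¬ HasPsdFactorization (pmOddCutSlack 8) 9 :=
  fun h => not_hasPsdFactorization_S3_nine (hasPsdFactorization_S3 h)

/-- `rk_psd(S_odd(K₈)) ≥ 10` in the `≤`-form. [cite: GouveiaRobinsonThomas2013, Prop. 2.6 + Lemma 2.4 + Ex. 2.3 (p05–p07)] -/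
theorem ten_le_of_hasPsdFactorization_eight {r : ℕ} (h : HasPsdFactorization (pmOddCutSlack 8) r) : 10 ≤ r := by
  by_contra hlt
  exact not_hasPsdFactorization_pmOddCutSlack_eight_nine (h.mono (by omega))

/-- **The `K₈` window `10 ≤ rk_psd(S_odd(K₈)) ≤ 14`**: the lower end by this file, the upper end by the exact
`S₈`-equivariant `Catalan(4)` factorisation of the companion file (`PsdRankSmall.hasPsdFactorization_pmOddCutSlack_eight`).
[cite: GouveiaRobinsonThomas2013, Prop. 2.6 + Lemma 2.4 + Ex. 2.3 (p05–p07); FawziEtAl2015, Thm. 2.9 (v) (p06–p07)] -/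
theorem pmOddCutSlack_eight_psdRank_window :
    HasPsdFactorization (pmOddCutSlack 8) 14 ∧ ∀ r, HasPsdFactorization (pmOddCutSlack 8) r → 10 ≤ r :=
  ⟨PsdRankSmall.hasPsdFactorization_pmOddCutSlack_eight, fun _ h => ten_le_of_hasPsdFactorization_eight h⟩

end Literature.Barriers.PneNP
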